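import Summits.QuantumAdvantage.AdviceFreeQNC0.AffBells26MoveSystems
import Summits.QuantumAdvantage.AdviceFreeQNC0.AffBells27FrameGlue
import Summits.QuantumAdvantage.AdviceFreeQNC0.AffBells29Shadow
import Literature.Computability.MetaComplexity.ParityModTestCosetDensity
import HarnessLib

/-!
# AffBells35 — the FIBRE-LEVEL reformulation of (NP₁): imperfect fibres, perfect stars, star counting (definitions and typed targets)

Cell qa-qnc0, route DWalkThree (crux stmt-QuantumAdvantage-22907; working rung (NP₁) `AffBells26.AffBellsPolyLoss3`).  AUTHORED BY THE
PLANNER SEAT qa-qnc0-p1 g35 (`HOME/qa-qnc0-p1/exp35/Sketch35.lean` §1 and §3, farm rc 0; memo ROUND-34 §2, §5, §9); landed VERBATIM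
(definitions and `Prop` targets only, nothing asserted) by qn-prover-3 g19 so that the prover asks P-38a (`PolyLossOfIFM`), P-38c
(`StarPartner`), P-38d (`StarCounting`) can be proved against tree names.  §2 of the sketch (holomorphic cube sums, `HoloCosetCover`) is
the Literature file `Literature.Computability.MetaComplexity.HoloCosetCover` (qn-lit g35, p702222) and is NOT restated here; §4 (the
`pairs2`/coset-Fourier targets) is still moving (ROUND-34 §11) and is left for a later append.

§1  `ImperfectAt`, `imperfectFibres`, `ImperfectFibreMass` (IFM), the glue target `PolyLossOfIFM` (IFM → `AffBellsPolyLoss3`; consumer of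
    DEN-3 = `ParityModTestDensity.parityMod3CosetDensity`, p696696) and `IFMCore`.
§3  `PerfectFibre`, `PerfectStar` (over the tree's cube objects `AffBells26.xS/Admissible/d`), `SightCompatible`, `CoversCoins`, the target
    `StarPartner`, `ImperfectStar`, and the elementary target `StarCounting` (proved in `AffBells35StarCounting`).
WHAT THIS IS NOT: no proof of any crux; 22907 untouched; separation NOT moved.
-/

namespace Summit.QuantumAdvantage.AdviceFreeQNC0.AffBells35

open Finset Classical Literature.Computability.QuantumComplexity Literature.Computability.QuantumComplexity.RingHLF
open AffBells23 Fib19 AffBells26 AffBells27 AffBells29 Literature.Computability.MetaComplexity.ParityModTestDensity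

noncomputable section

/-! ### §1 The fibre-level reformulation -/

variable {N : ℕ}

/-- The fibre of `x` (odd inputs with the same kernel line) contains a LOSER. -/
def ImperfectAt (β : Fin N → Fin N → ZMod 3) (c : Fin N → ZMod 3) (x : Fin N → Bool) : Prop :=
  ∃ x' : Fin N → Bool, IsOdd x' ∧ kline x' = kline x ∧ ¬ RingHLF.Rel x' (affBell β c x')

/-- Odd inputs lying in an imperfect fibre. -/
def imperfectFibres (β : Fin N → Fin N → ZMod 3) (c : Fin N → ZMod 3) : Finset (Fin N → Bool) :=
  univ.filter fun x => IsOdd x ∧ ImperfectAt β c x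

/-- **(IFM)** imperfect fibres carry an inverse-polynomial fraction of the odd class. Given DEN-3 this is
EQUIVALENT to `(NP₁)`: a fibre is either perfect or loses a `(N+1)^{-16}` fraction of itself. -/
def ImperfectFibreMass : Prop :=
  ∃ C n₀ : ℕ, ∀ N ≥ n₀, ∀ (β : Fin N → Fin N → ZMod 3) (c : Fin N → ZMod 3),
    (2 : ℝ) ^ (N - 1) ≤ (N : ℝ) ^ C * ((imperfectFibres β c).card : ℝ)

/-- **P-38a (S) glue target.** IFM → (NP₁): parametrise the fibre of `J` by its coins (`card_fibre`, `apply_eq_of_kline`),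
read `win` on the fibre as `parityMod3` of the `N − Z` active tests on the parity coset (`targetFormula`), apply
`parityMod3CosetDensity` (`#H_ε ≤ (s+1)^16 · #losers`, `s ≤ N`), sum over imperfect fibres. -/
def PolyLossOfIFM : Prop := ImperfectFibreMass → AffBellsPolyLoss3

/-- **(IFM-core)** — the fibre-level residual in the shape of `OddCubeAbundanceCorePL` (HOME exp34/OddCube34.lean §9):
not frame-decomposable, not polylog-coverable ⇒ imperfect-fibre mass inverse-polynomial OR the escape `win ≤ 3/4`. -/
def IFMCore (Cw : ℕ) : Prop :=
  ∃ δ₀ : ℝ, δ₀ < 1 / 2 ∧ ∃ r₀ w₀ C n₀ : ℕ, ∀ N ≥ n₀, ∀ (β : Fin N → Fin N → ZMod 3) (c : Fin N → ZMod 3),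
    ¬ FrameDecomp δ₀ r₀ w₀ β →
    (∀ W : Finset (Fin N), 3 * W.card ≤ N → ∃ b, (Nat.log 2 N) ^ Cw < (rowSupp β b \ W).card) →
    (2 : ℝ) ^ (N - 1) ≤ (N : ℝ) ^ C * ((imperfectFibres β c).card : ℝ) ∨
      4 * (affWinCard β c : ℝ) ≤ 3 * (2 : ℝ) ^ (N - 1)

/-! ### §3 Perfect fibres, perfect stars, and the star-partner target -/

/-- The fibre of the hard-core vector `J` is PERFECT: every odd input on it wins. -/
def PerfectFibre (β : Fin N → Fin N → ZMod 3) (c : Fin N → ZMod 3) (J : Fin N → Bool) : Prop :=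
  ∀ x : Fin N → Bool, IsOdd x → kline x = J → RingHLF.Rel x (affBell β c x)

/-- The star rooted at `x` with (admissible) site set `H` is perfect: all `2^{|H|}` created fibres are perfect. -/
def PerfectStar (β : Fin N → Fin N → ZMod 3) (c : Fin N → ZMod 3) (x : Fin N → Bool) (H : Finset (Fin N)) : Prop :=
  ∀ S ⊆ H, PerfectFibre β c (kline (xS x S))

/-- `g` is SIGHT-COMPATIBLE with `b` on the sites `H` (root pattern `x`): for one sign `λ ∈ {1,2}`, at every site `h ≠ g` either `g` is
blind (`d = 0`, a wildcard: presence polynomial) or `d_g(h) = λ·d_b(h)`.  These are exactly the rows whose characters on `𝔽₃^H` can meet `b`'s. -/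
def SightCompatible (β : Fin N → Fin N → ZMod 3) (x : Fin N → Bool) (H : Finset (Fin N)) (b g : Fin N) : Prop :=
  ∃ l : ZMod 3, l ≠ 0 ∧ ∀ h ∈ H, h ≠ g → d β x g h = 0 ∨ d β x g h = l * d β x b h

/-- `g` covers `b` on the COINS of the root (`kline x a = false`), up to `≤ 2` exceptions. -/
def CoversCoins (β : Fin N → Fin N → ZMod 3) (x : Fin N → Bool) (b g : Fin N) : Prop :=
  (univ.filter fun a => kline x a = false ∧ β b a ≠ 0 ∧ β g a = 0).card ≤ 2

/-- **P-38c (M) STAR PARTNER** — the theorem of the free-site character method (S3 + bilinear trick + `HoloCosetCover`):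
in a perfect star, an active, non-site row `b` that sees every site and meets the coins has an ACTIVE partner `g ≠ b` that is
sight-compatible with `b` and covers `b`'s coin support.  Rows with generic shift signs never qualify — no `(Q-iso)` needed. -/
def StarPartner : Prop :=
  ∀ N : ℕ, 8 ≤ N → ∀ (β : Fin N → Fin N → ZMod 3) (c : Fin N → ZMod 3) (x : Fin N → Bool) (H : Finset (Fin N)) (b : Fin N),
    IsOdd x → Admissible x H → 3 ≤ zeros (kline x) → PerfectStar β c x H →
    kline x b = true → b ∉ H → (∀ h ∈ H, d β x b h ≠ 0) → (∃ a, kline x a = false ∧ β b a ≠ 0) →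
    ∃ g : Fin N, g ≠ b ∧ kline x g = true ∧ SightCompatible β x H b g ∧ CoversCoins β x b g

/-- The star at `(x, H)` is IMPERFECT in the counted sense: some created input `x_S` (`S ⊆ H`) is odd and lies in an imperfect fibre.
(Under `Admissible x H` this is `¬ PerfectStar β c x H`: `x_S` is odd by `kline_xS`.) -/
def ImperfectStar (β : Fin N → Fin N → ZMod 3) (c : Fin N → ZMod 3) (x : Fin N → Bool) (H : Finset (Fin N)) : Prop :=
  ∃ S ⊆ H, IsOdd (xS x S) ∧ ImperfectAt β c (xS x S)

/-- **P-38d (S) STAR COUNTING** — the fibre-level replacement of cube descent: if every root `x ∈ X` has an `η`-fraction of the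
`k`-subsets of the window `R` carrying an imperfect star, then the imperfect fibres hold `≥ η·|X|/2^k` odd inputs.
(Double count the triples `(x, H, S)`; `x ↦ x_S` is injective for fixed `S`; each odd input of an imperfect fibre is hit by
`≤ C(|R|,k)·2^k` pairs `(H, S)`.)  With `k = C' log₂ N` the loss `2^k = N^{C'}` is polynomial. -/
def StarCounting : Prop :=
  ∀ (N k : ℕ) (β : Fin N → Fin N → ZMod 3) (c : Fin N → ZMod 3) (R : Finset (Fin N)) (X : Finset (Fin N → Bool)) (η : ℝ),
    k ≤ R.card → (∀ x ∈ X, IsOdd x) →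
    (∀ x ∈ X, η * ((R.powersetCard k).card : ℝ) ≤ (((R.powersetCard k).filter fun H => ImperfectStar β c x H).card : ℝ)) →
    η * (X.card : ℝ) ≤ (2 : ℝ) ^ k * ((imperfectFibres β c).card : ℝ)

end

end Summit.QuantumAdvantage.AdviceFreeQNC0.AffBells35
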